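import Summits.ValiantsHypothesis.ValiantsHypothesis.Theorems.LacunarySymmetroidMatrixDescartesPivotDeflationOverlap

/-!
# `MatrixDescartes` census — DIRECTIONAL NESTING of islands under deflation (pivot column, m = 2)

HONEST FRAMING.  Structure theorems for the object-search cell `pub-symmetroid`'s pivot column
(`…CensusPivotDefs`: `pivotPosRoots`, `PivotRootLawAt`; the open m = 2 row «(2,K) ≤ 2K», located cell
(2,4)₁ ∈ {8,9,10}).  Landed `--supports stmt-ValiantsHypothesis-18050` as a helper; it proves NO bound on any
pivot row and says nothing about `Theses.LacunarySymmetroid.MatrixDescartes`, DoorA26/DoorA34, the census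
registers or `VP ≠ VNP`.

THE LAWS.  `F(X) = X^e • J + ∑ₖ X^{d k} • P k` with all `P k ⪰ 0`, deflations `F̃_D(u) = (D − e)u^e • J + ∑ (D − d k)u^{d k} • P k`
(`…PivotDeflationPassage`, `…PivotDeflationOverlap`).  Fix a direction `v`; the DIRECTIONAL ISLAND of a pencil in the
direction `v` is the set of `u > 0` with `vᵀ(pencil at u)v < 0` (an interval, by Descartes: one negative coefficient).
With `Dp > e` («top» level, e.g. `max d k`) and `Dm < e` («bottom» level, e.g. `min d k`):

* `nonneg_from_of_deflateTop_nonneg_from` (CONTAINMENT, top): if the `Dp`-deflated form is `≥ 0` on `v` from `u₁` on,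
  then so is `F` — the island of `F` in the direction `v` ENDS no later than the top-deflated island ends;
* `nonneg_until_of_deflateBot_nonpos_until` (CONTAINMENT, bottom): if the `Dm`-deflated form is `≤ 0` on `v` up to `u₁`
  (the bottom-deflated pivot pencil `−F̃_{Dm}` is `≥ 0` there), then `F` is `≥ 0` on `v` up to `u₁` — the island of `F`
  STARTS no earlier than the bottom-deflated island starts;
* `det_nonneg_from_of_deflateTop_psd_from` / `det_nonneg_until_of_deflateBot_psd_until`: hence `det F` does not change
  sign after the last island of the top deflation nor before the first island of the bottom deflation;
* `neg_at_start_of_deflateTop_island` (STRADDLE, top): if the top-deflated form on `v` is `> 0` on `(0, ã)`, `< 0` on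
  `(ã, b̃)` and `≥ 0` from `b̃` on, and `F` is negative on `v` somewhere, then `F` is negative on `v` AT `ã` — the island of
  `F` contains the START of the top-deflated island (so it starts strictly earlier);
* `neg_at_end_of_deflateBot_island` (STRADDLE, bottom): mirror — the island of `F` contains the END of the
  bottom-deflated island.

Mechanism: `u ↦ vᵀF(u)v / u^D` has derivative `−vᵀF̃_D(u)v / u^{D+1}` (`Passage.hasDerivAt_quadForm_div_pow`), so it is
monotone on the pieces where the deflated form has a sign, and `vᵀF(u)v ≥ u^e·vᵀJv` forbids a negative limit behaviour
at `0` or `∞`.  Together with `Overlap.exists_overlap_of_neg` / `neg_of_overlap` this is the complete directional picture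
`ã′ ≤ a < ã < b̃′ < b ≤ b̃` for the islands `(a,b) ⊃ …` of `F`, `(ã,b̃)` of its top deflation, `(ã′,b̃′)` of its bottom
deflation, in every direction; nothing is claimed about the number of directions (arcs) carrying islands.

[folklore] monotonicity from the sign of a derivative (mean value theorem), elementary growth estimates.
-/

-- `Summit.ValiantsHypothesis.ValiantsHypothesis.…` repeats a component by the D-0017 layout
-- (single-conjunct summit), which the `dupNamespace` linter flags; the name is mandated.
set_option linter.dupNamespace false

namespace Summit.ValiantsHypothesis.ValiantsHypothesis.Theorems.LacunarySymmetroidMatrixDescartes.Pivot.Fibres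

open Polynomial Matrix Finset
open scoped BigOperators
open Summit.ValiantsHypothesis.ValiantsHypothesis.Theorems.LacunarySymmetroidMatrixDescartes.Pivot.Deflation

variable {K : ℕ}

/-- The letter part of the directional form is non-negative: `vᵀF(u)v ≥ u^e · vᵀJv` for `u ≥ 0`. -/
theorem quadForm_pencil_ge_pivot (e : ℕ) (d : Fin K → ℕ) (J : Matrix (Fin 2) (Fin 2) ℝ)
    (P : Fin K → Matrix (Fin 2) (Fin 2) ℝ) (hP : ∀ k, (P k).PosSemidef) (v : Fin 2 → ℝ) {u : ℝ} (hu : 0 ≤ u) :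
    u ^ e * dotProduct v (J.mulVec v) ≤ dotProduct v ((u ^ e • J + ∑ k, u ^ d k • P k).mulVec v) := by
  rw [Overlap.quadForm_pencil_eq]
  have : 0 ≤ ∑ k, u ^ d k * dotProduct v ((P k).mulVec v) := Finset.sum_nonneg fun k _ =>
    mul_nonneg (pow_nonneg hu _) (by simpa only [star_trivial] using (hP k).dotProduct_mulVec_nonneg v)
  linarith

/-- Monotonicity on a closed piece: if the `D`-deflated form is `≥ 0` on `v` on `[u₁, u₂]` (`0 < u₁`), then
`vᵀF(u)v/u^D` is antitone there. -/
theorem antitoneOn_of_deflate_nonneg (e D : ℕ) (d : Fin K → ℕ) (J : Matrix (Fin 2) (Fin 2) ℝ)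
    (P : Fin K → Matrix (Fin 2) (Fin 2) ℝ) (v : Fin 2 → ℝ) {u₁ u₂ : ℝ} (hu₁ : 0 < u₁)
    (h : ∀ u ∈ Set.Icc u₁ u₂, 0 ≤ dotProduct v (((((D : ℝ) - e) * u ^ e) • J
        + ∑ k, (((D : ℝ) - d k) * u ^ d k) • P k).mulVec v)) :
    AntitoneOn (fun u : ℝ => dotProduct v ((u ^ e • J + ∑ k, u ^ d k • P k).mulVec v) / u ^ D)
      (Set.Icc u₁ u₂) := by
  refine antitoneOn_of_deriv_nonpos (convex_Icc u₁ u₂) (fun x hx => ?_) (fun x hx => ?_) (fun x hx => ?_)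
  · exact (Passage.hasDerivAt_quadForm_div_pow e D d J P v (hu₁.trans_le hx.1)).continuousAt.continuousWithinAt
  · have hx' : x ∈ Set.Icc u₁ u₂ := interior_subset hx
    exact (Passage.hasDerivAt_quadForm_div_pow e D d J P v (hu₁.trans_le hx'.1)).differentiableAt.differentiableWithinAt
  · have hx' : x ∈ Set.Icc u₁ u₂ := interior_subset hx
    have hx0 : 0 < x := hu₁.trans_le hx'.1
    rw [(Passage.hasDerivAt_quadForm_div_pow e D d J P v hx0).deriv]
    exact div_nonpos_of_nonpos_of_nonneg (neg_nonpos.2 (h x hx')) (pow_nonneg hx0.le _)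

/-- Mirror: if the `D`-deflated form is `≤ 0` on `v` on `[u₁, u₂]` (`0 < u₁`), then `vᵀF(u)v/u^D` is monotone there. -/
theorem monotoneOn_of_deflate_nonpos (e D : ℕ) (d : Fin K → ℕ) (J : Matrix (Fin 2) (Fin 2) ℝ)
    (P : Fin K → Matrix (Fin 2) (Fin 2) ℝ) (v : Fin 2 → ℝ) {u₁ u₂ : ℝ} (hu₁ : 0 < u₁)
    (h : ∀ u ∈ Set.Icc u₁ u₂, dotProduct v (((((D : ℝ) - e) * u ^ e) • J
        + ∑ k, (((D : ℝ) - d k) * u ^ d k) • P k).mulVec v) ≤ 0) :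
    MonotoneOn (fun u : ℝ => dotProduct v ((u ^ e • J + ∑ k, u ^ d k • P k).mulVec v) / u ^ D)
      (Set.Icc u₁ u₂) := by
  refine monotoneOn_of_deriv_nonneg (convex_Icc u₁ u₂) (fun x hx => ?_) (fun x hx => ?_) (fun x hx => ?_)
  · exact (Passage.hasDerivAt_quadForm_div_pow e D d J P v (hu₁.trans_le hx.1)).continuousAt.continuousWithinAt
  · have hx' : x ∈ Set.Icc u₁ u₂ := interior_subset hx
    exact (Passage.hasDerivAt_quadForm_div_pow e D d J P v (hu₁.trans_le hx'.1)).differentiableAt.differentiableWithinAt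
  · have hx' : x ∈ Set.Icc u₁ u₂ := interior_subset hx
    have hx0 : 0 < x := hu₁.trans_le hx'.1
    rw [(Passage.hasDerivAt_quadForm_div_pow e D d J P v hx0).deriv]
    exact div_nonneg (neg_nonneg.2 (h x hx')) (pow_nonneg hx0.le _)

/-! ## Containment: the island of `F` lies inside the hull of the deflated islands -/

/-- **CONTAINMENT (top).**  `P k ⪰ 0`, `e < Dp`.  If the `Dp`-deflated form is `≥ 0` on `v` for all `u ≥ u₁` (`u₁ > 0`),
then `vᵀF(u)v ≥ 0` for all `u ≥ u₁`: in the direction `v` the island of `F` ends no later than the island of the top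
deflation. [mechanism: `vᵀFv/u^{Dp}` is antitone from `u₁` on, and `vᵀF(u)v ≥ u^e·vᵀJv` forbids a negative value
to persist against `u^{Dp}`] -/
theorem nonneg_from_of_deflateTop_nonneg_from (e Dp : ℕ) (d : Fin K → ℕ) (J : Matrix (Fin 2) (Fin 2) ℝ)
    (P : Fin K → Matrix (Fin 2) (Fin 2) ℝ) (hP : ∀ k, (P k).PosSemidef) (hDp : e < Dp) (v : Fin 2 → ℝ)
    {u₁ : ℝ} (hu₁ : 0 < u₁)
    (htop : ∀ u : ℝ, u₁ ≤ u → 0 ≤ dotProduct v (((((Dp : ℝ) - e) * u ^ e) • J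
        + ∑ k, (((Dp : ℝ) - d k) * u ^ d k) • P k).mulVec v))
    {u : ℝ} (hu : u₁ ≤ u) : 0 ≤ dotProduct v ((u ^ e • J + ∑ k, u ^ d k • P k).mulVec v) := by
  by_contra hneg
  rw [not_le] at hneg
  set cJ := dotProduct v (J.mulVec v) with hcJ
  have hu0 : 0 < u := hu₁.trans_le hu
  -- the witness point far out
  set h₀ := dotProduct v ((u ^ e • J + ∑ k, u ^ d k • P k).mulVec v) / u ^ Dp with hh₀
  have hh₀neg : h₀ < 0 := div_neg_of_neg_of_pos hneg (pow_pos hu0 _)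
  set w : ℝ := max u 1 + cJ / h₀ + 1 with hw
  rcases le_or_gt 0 cJ with hcJ0 | hcJ0
  · -- `cJ ≥ 0`: already `vᵀF(u)v ≥ 0`
    have := quadForm_pencil_ge_pivot e d J P hP v hu0.le
    have : 0 ≤ u ^ e * cJ := mul_nonneg (pow_nonneg hu0.le _) hcJ0
    linarith
  · have hR : 0 < cJ / h₀ := div_pos_of_neg_of_neg hcJ0 hh₀neg
    have hwu : u ≤ w := by rw [hw]; linarith [le_max_left u 1, hR]
    have hw1 : 1 ≤ w := by rw [hw]; linarith [le_max_right u 1, hR]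
    have hw0 : 0 < w := by linarith
    have hwR : cJ / h₀ < w := by rw [hw]; linarith [le_max_right u 1, hu0]
    -- antitone on `[u, w]`
    have hanti := antitoneOn_of_deflate_nonneg e Dp d J P v hu0 (u₂ := w)
      (fun x hx => htop x (hu.trans hx.1))
    have hle : dotProduct v ((w ^ e • J + ∑ k, w ^ d k • P k).mulVec v) / w ^ Dp ≤ h₀ :=
      hanti ⟨le_rfl, hwu⟩ ⟨hwu, le_rfl⟩ hwu
    have h1 : dotProduct v ((w ^ e • J + ∑ k, w ^ d k • P k).mulVec v) ≤ h₀ * w ^ Dp := by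
      rwa [div_le_iff₀ (pow_pos hw0 _)] at hle
    have h2 : w ^ e * cJ ≤ dotProduct v ((w ^ e • J + ∑ k, w ^ d k • P k).mulVec v) :=
      quadForm_pencil_ge_pivot e d J P hP v hw0.le
    -- `w^e·cJ ≤ h₀·w^{Dp} = h₀·w^e·w^{Dp−e}` and `w^{Dp−e} ≥ w > cJ/h₀`
    have hsplit : w ^ Dp = w ^ e * w ^ (Dp - e) := by rw [← pow_add]; congr 1; omega
    have hwpow : w ≤ w ^ (Dp - e) := by
      calc w = w ^ 1 := (pow_one w).symm
        _ ≤ w ^ (Dp - e) := pow_le_pow_right₀ hw1 (by omega)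
    have h3 : cJ ≤ h₀ * w ^ (Dp - e) := by
      have := h2.trans h1
      rw [hsplit, ← mul_assoc, mul_comm h₀, mul_assoc] at this
      exact le_of_mul_le_mul_left this (pow_pos hw0 _)
    -- but `h₀ · w^{Dp−e} ≤ h₀ · w < h₀ · (cJ/h₀) = cJ`
    have h4 : h₀ * w ^ (Dp - e) ≤ h₀ * w := mul_le_mul_of_nonpos_left hwpow hh₀neg.le
    have h5 : h₀ * w < h₀ * (cJ / h₀) := mul_lt_mul_of_neg_left hwR hh₀neg
    rw [mul_div_cancel₀ _ hh₀neg.ne] at h5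
    linarith

/-- **CONTAINMENT (bottom).**  `P k ⪰ 0`, `Dm < e`.  If the `Dm`-deflated form is `≤ 0` on `v` for all `u ∈ (0, u₁]`
(the bottom-deflated pivot pencil `−F̃_{Dm}` is `≥ 0` there), then `vᵀF(u)v ≥ 0` on `(0, u₁]`: in the direction `v` the
island of `F` starts no earlier than the island of the bottom deflation. -/
theorem nonneg_until_of_deflateBot_nonpos_until (e Dm : ℕ) (d : Fin K → ℕ) (J : Matrix (Fin 2) (Fin 2) ℝ)
    (P : Fin K → Matrix (Fin 2) (Fin 2) ℝ) (hP : ∀ k, (P k).PosSemidef) (hDm : Dm < e) (v : Fin 2 → ℝ)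
    {u₁ : ℝ}
    (hbot : ∀ u : ℝ, 0 < u → u ≤ u₁ → dotProduct v (((((Dm : ℝ) - e) * u ^ e) • J
        + ∑ k, (((Dm : ℝ) - d k) * u ^ d k) • P k).mulVec v) ≤ 0)
    {u : ℝ} (hu0 : 0 < u) (hu : u ≤ u₁) : 0 ≤ dotProduct v ((u ^ e • J + ∑ k, u ^ d k • P k).mulVec v) := by
  by_contra hneg
  rw [not_le] at hneg
  set cJ := dotProduct v (J.mulVec v) with hcJ
  set h₀ := dotProduct v ((u ^ e • J + ∑ k, u ^ d k • P k).mulVec v) / u ^ Dm with hh₀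
  have hh₀neg : h₀ < 0 := div_neg_of_neg_of_pos hneg (pow_pos hu0 _)
  rcases le_or_gt 0 cJ with hcJ0 | hcJ0
  · have := quadForm_pencil_ge_pivot e d J P hP v hu0.le
    have : 0 ≤ u ^ e * cJ := mul_nonneg (pow_nonneg hu0.le _) hcJ0
    linarith
  · -- the witness point close to `0`: `w ≤ u`, `w ≤ 1`, `w < h₀/cJ`
    have hR : 0 < h₀ / cJ := div_pos_of_neg_of_neg hh₀neg hcJ0
    set w : ℝ := min u (min 1 (h₀ / cJ)) / 2 with hw
    have hmin : 0 < min u (min 1 (h₀ / cJ)) := lt_min hu0 (lt_min one_pos hR)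
    have hw0 : 0 < w := by rw [hw]; linarith
    have hwu : w ≤ u := by rw [hw]; linarith [min_le_left u (min 1 (h₀ / cJ))]
    have hw1 : w ≤ 1 := by
      rw [hw]; linarith [min_le_right u (min 1 (h₀ / cJ)), min_le_left (1:ℝ) (h₀ / cJ)]
    have hwR : w < h₀ / cJ := by
      rw [hw]; linarith [min_le_right u (min 1 (h₀ / cJ)), min_le_right (1:ℝ) (h₀ / cJ)]
    have hmono := monotoneOn_of_deflate_nonpos e Dm d J P v hw0 (u₂ := u)
      (fun x hx => hbot x (hw0.trans_le hx.1) (hx.2.trans hu))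
    have hle : dotProduct v ((w ^ e • J + ∑ k, w ^ d k • P k).mulVec v) / w ^ Dm ≤ h₀ :=
      hmono ⟨le_rfl, hwu⟩ ⟨hwu, le_rfl⟩ hwu
    have h1 : dotProduct v ((w ^ e • J + ∑ k, w ^ d k • P k).mulVec v) ≤ h₀ * w ^ Dm := by
      rwa [div_le_iff₀ (pow_pos hw0 _)] at hle
    have h2 : w ^ e * cJ ≤ dotProduct v ((w ^ e • J + ∑ k, w ^ d k • P k).mulVec v) :=
      quadForm_pencil_ge_pivot e d J P hP v hw0.le
    have hsplit : w ^ e = w ^ Dm * w ^ (e - Dm) := by rw [← pow_add]; congr 1; omega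
    have hwpow : w ^ (e - Dm) ≤ w := by
      calc w ^ (e - Dm) ≤ w ^ 1 := pow_le_pow_of_le_one hw0.le hw1 (by omega)
        _ = w := pow_one w
    -- `w^{Dm}·(w^{e−Dm}·cJ) ≤ h₀·w^{Dm}` gives `w^{e−Dm}·cJ ≤ h₀`, i.e. `w^{e−Dm} ≥ h₀/cJ`; but `w^{e−Dm} ≤ w < h₀/cJ`
    have h3 : w ^ (e - Dm) * cJ ≤ h₀ := by
      have := h2.trans h1
      rw [hsplit, mul_assoc, mul_comm h₀] at this
      exact le_of_mul_le_mul_left this (pow_pos hw0 _)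
    have h4 : w * cJ ≤ w ^ (e - Dm) * cJ := mul_le_mul_of_nonpos_right hwpow hcJ0.le
    have h5 : (h₀ / cJ) * cJ < w * cJ := mul_lt_mul_of_neg_right hwR hcJ0
    rw [div_mul_cancel₀ _ hcJ0.ne] at h5
    linarith

/-- A symmetric `2 × 2` form that is `≥ 0` on every vector has `a c − b² ≥ 0`. [folklore] -/
theorem det_nonneg_of_quadForm_nonneg (a b c : ℝ) (h : ∀ x y : ℝ, 0 ≤ a * x ^ 2 + 2 * b * x * y + c * y ^ 2) :
    0 ≤ a * c - b ^ 2 := by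
  have ha : 0 ≤ a := by simpa using h 1 0
  rcases ha.eq_or_lt with ha0 | hapos
  · -- `a = 0` forces `b = 0`
    have hb : b = 0 := by
      by_contra hb
      have h1 := h (-(c + 1) / (2 * b)) 1
      rw [← ha0] at h1
      have : 2 * b * (-(c + 1) / (2 * b)) * 1 = -(c + 1) := by field_simp
      nlinarith [this]
    rw [← ha0, hb]; simp
  · have h2 := h b (-a)
    have e : a * b ^ 2 + 2 * b * b * -a + c * (-a) ^ 2 = a * (a * c - b ^ 2) := by ring
    rw [e] at h2
    by_contra hc
    rw [not_le] at hc
    have : a * (a * c - b ^ 2) < 0 := mul_neg_of_pos_of_neg hapos hc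
    linarith

/-- **NO SIGN CHANGE AFTER THE LAST TOP ISLAND.**  `J` symmetric, `P k ⪰ 0`, `e < Dp`.  If the `Dp`-deflated pencil is
positive semi-definite for all `u ≥ u₁` (`u₁ > 0`; no island of the top deflation after `u₁`), then `det F(u) ≥ 0` for all
`u ≥ u₁`: the determinant of the `K`-letter pencil does not change sign after the last island of its top deflation. -/
theorem det_nonneg_from_of_deflateTop_psd_from (e Dp : ℕ) (d : Fin K → ℕ) (J : Matrix (Fin 2) (Fin 2) ℝ)
    (P : Fin K → Matrix (Fin 2) (Fin 2) ℝ) (hJ : J.IsSymm) (hP : ∀ k, (P k).PosSemidef) (hDp : e < Dp)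
    {u₁ : ℝ} (hu₁ : 0 < u₁)
    (htop : ∀ u : ℝ, u₁ ≤ u → ∀ v : Fin 2 → ℝ, 0 ≤ dotProduct v (((((Dp : ℝ) - e) * u ^ e) • J
        + ∑ k, (((Dp : ℝ) - d k) * u ^ d k) • P k).mulVec v))
    {u : ℝ} (hu : u₁ ≤ u) :
    0 ≤ (Matrix.det (((Polynomial.X : ℝ[X]) ^ e) • Matrix.map J Polynomial.C
          + ∑ k, ((Polynomial.X : ℝ[X]) ^ d k) • Matrix.map (P k) Polynomial.C)).eval u := by
  have hsym := comb_symm (u ^ e) (fun k => u ^ d k) J P hJ (fun k => Passage.isSymm_of_posSemidef (hP k))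
  rw [Tangency.eval_det_pencil, hsym, ← sq]
  refine det_nonneg_of_quadForm_nonneg _ _ _ fun x y => ?_
  have := nonneg_from_of_deflateTop_nonneg_from e Dp d J P hP hDp ![x, y] hu₁ (fun w hw => htop w hw _) hu
  rw [quadForm_fin_two _ hsym] at this
  simpa using this

/-- **NO SIGN CHANGE BEFORE THE FIRST BOTTOM ISLAND.**  Mirror statement: if the `Dm`-deflated form is `≤ 0` on every
direction for all `u ∈ (0, u₁]` (the bottom-deflated pivot pencil is positive semi-definite there), then `det F(u) ≥ 0`
on `(0, u₁]`. -/
theorem det_nonneg_until_of_deflateBot_psd_until (e Dm : ℕ) (d : Fin K → ℕ) (J : Matrix (Fin 2) (Fin 2) ℝ)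
    (P : Fin K → Matrix (Fin 2) (Fin 2) ℝ) (hJ : J.IsSymm) (hP : ∀ k, (P k).PosSemidef) (hDm : Dm < e)
    {u₁ : ℝ}
    (hbot : ∀ u : ℝ, 0 < u → u ≤ u₁ → ∀ v : Fin 2 → ℝ, dotProduct v (((((Dm : ℝ) - e) * u ^ e) • J
        + ∑ k, (((Dm : ℝ) - d k) * u ^ d k) • P k).mulVec v) ≤ 0)
    {u : ℝ} (hu0 : 0 < u) (hu : u ≤ u₁) :
    0 ≤ (Matrix.det (((Polynomial.X : ℝ[X]) ^ e) • Matrix.map J Polynomial.C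
          + ∑ k, ((Polynomial.X : ℝ[X]) ^ d k) • Matrix.map (P k) Polynomial.C)).eval u := by
  have hsym := comb_symm (u ^ e) (fun k => u ^ d k) J P hJ (fun k => Passage.isSymm_of_posSemidef (hP k))
  rw [Tangency.eval_det_pencil, hsym, ← sq]
  refine det_nonneg_of_quadForm_nonneg _ _ _ fun x y => ?_
  have := nonneg_until_of_deflateBot_nonpos_until e Dm d J P hP hDm ![x, y]
    (fun w hw0 hw => hbot w hw0 hw _) hu0 hu
  rw [quadForm_fin_two _ hsym] at this
  simpa using this

/-! ## Straddle: the island of `F` contains the start of the top island and the end of the bottom island -/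

/-- **STRADDLE (top).**  `P k ⪰ 0`, `e < Dp`, `0 < ã ≤ b̃`.  Suppose that in the direction `v` the `Dp`-deflated form is
`> 0` on `(0, ã)`, `< 0` on `(ã, b̃)` and `≥ 0` from `b̃` on (its directional island is `(ã, b̃)`).  If `vᵀF(u₂)v < 0` for
some `u₂ > 0`, then `vᵀF(ã)v < 0`: the island of `F` in the direction `v` contains the START of the top-deflated island. -/
theorem neg_at_start_of_deflateTop_island (e Dp : ℕ) (d : Fin K → ℕ) (J : Matrix (Fin 2) (Fin 2) ℝ)
    (P : Fin K → Matrix (Fin 2) (Fin 2) ℝ) (hP : ∀ k, (P k).PosSemidef) (hDp : e < Dp) (v : Fin 2 → ℝ)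
    {a b : ℝ} (ha : 0 < a) (hab : a ≤ b)
    (hbefore : ∀ u ∈ Set.Ioo 0 a, 0 < dotProduct v (((((Dp : ℝ) - e) * u ^ e) • J
        + ∑ k, (((Dp : ℝ) - d k) * u ^ d k) • P k).mulVec v))
    (hinside : ∀ u ∈ Set.Ioo a b, dotProduct v (((((Dp : ℝ) - e) * u ^ e) • J
        + ∑ k, (((Dp : ℝ) - d k) * u ^ d k) • P k).mulVec v) < 0)
    (hafter : ∀ u : ℝ, b ≤ u → 0 ≤ dotProduct v (((((Dp : ℝ) - e) * u ^ e) • J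
        + ∑ k, (((Dp : ℝ) - d k) * u ^ d k) • P k).mulVec v))
    {u₂ : ℝ} (hu₂ : 0 < u₂) (hneg : dotProduct v ((u₂ ^ e • J + ∑ k, u₂ ^ d k • P k).mulVec v) < 0) :
    dotProduct v ((a ^ e • J + ∑ k, a ^ d k • P k).mulVec v) < 0 := by
  set φ : ℝ → ℝ := fun u => dotProduct v ((u ^ e • J + ∑ k, u ^ d k • P k).mulVec v) / u ^ Dp with hφ
  have hφu₂ : φ u₂ < 0 := div_neg_of_neg_of_pos hneg (pow_pos hu₂ _)
  -- `u₂ < b` by containment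
  have hu₂b : u₂ < b := by
    by_contra h
    rw [not_lt] at h
    have := nonneg_from_of_deflateTop_nonneg_from e Dp d J P hP hDp v (ha.trans_le hab) hafter h
    linarith
  -- compare `φ a` with `φ u₂`
  suffices hφa : φ a < 0 by
    have : φ a * a ^ Dp = dotProduct v ((a ^ e • J + ∑ k, a ^ d k • P k).mulVec v) := by
      simp only [hφ]; rw [div_mul_cancel₀ _ (pow_ne_zero _ ha.ne')]
    rw [← this]; exact mul_neg_of_neg_of_pos hφa (pow_pos ha _)
  rcases lt_trichotomy u₂ a with hlt | heq | hgt
  · -- strictly decreasing on `(0, a)` up to `a`: `φ a < φ u₂`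
    have hanti := Passage.quadForm_div_pow_strictAntiOn e Dp d J P v (le_refl (0:ℝ)) hbefore
    -- pass to the closed end `a` by continuity-free monotonicity on `[u₂, a]` (deflated form `≥ 0` on `[u₂, a)`,
    -- and the value at `a` is a limit of smaller values): use antitone on `[u₂, a]` via `≥ 0` on `[u₂, a]`
    have hnn : ∀ u ∈ Set.Icc u₂ a, 0 ≤ dotProduct v (((((Dp : ℝ) - e) * u ^ e) • J
        + ∑ k, (((Dp : ℝ) - d k) * u ^ d k) • P k).mulVec v) := by
      intro u hu
      rcases lt_or_eq_of_le hu.2 with h | h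
      · exact (hbefore u ⟨hu₂.trans_le hu.1, h⟩).le
      · -- at `u = a`: by continuity from the left
        rw [h]
        have hcont : ContinuousAt (fun u : ℝ => dotProduct v (((((Dp : ℝ) - e) * u ^ e) • J
            + ∑ k, (((Dp : ℝ) - d k) * u ^ d k) • P k).mulVec v)) a := by
          simp only [Overlap.quadForm_deflate_eq]; fun_prop
        exact ge_of_tendsto (hcont.continuousWithinAt (s := Set.Iio a)).tendsto
          (Filter.eventually_of_mem (Ioo_mem_nhdsLT ha) fun u hu => (hbefore u hu).le)
    have hmonoI := antitoneOn_of_deflate_nonneg e Dp d J P v hu₂ (u₂ := a) hnn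
    have h1 : φ a ≤ φ ((u₂ + a) / 2) := hmonoI ⟨by linarith, by linarith⟩ ⟨by linarith, le_rfl⟩ (by linarith)
    have h2 : φ ((u₂ + a) / 2) < φ u₂ := hanti ⟨hu₂, hlt⟩ ⟨by linarith, by linarith⟩ (by linarith)
    linarith
  · rw [← heq]; exact hφu₂
  · -- strictly increasing on `(a, b)`, `u₂ ∈ (a, b)`: `φ a ≤ φ ((a+u₂)/2) < φ u₂`
    have hmono := Passage.quadForm_div_pow_strictMonoOn e Dp d J P v ha.le hinside
    have hnp : ∀ u ∈ Set.Icc a u₂, dotProduct v (((((Dp : ℝ) - e) * u ^ e) • J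
        + ∑ k, (((Dp : ℝ) - d k) * u ^ d k) • P k).mulVec v) ≤ 0 := by
      intro u hu
      rcases lt_or_eq_of_le hu.1 with h | h
      · exact (hinside u ⟨h, lt_of_le_of_lt hu.2 hu₂b⟩).le
      · rw [← h]
        have hcont : ContinuousAt (fun u : ℝ => dotProduct v (((((Dp : ℝ) - e) * u ^ e) • J
            + ∑ k, (((Dp : ℝ) - d k) * u ^ d k) • P k).mulVec v)) a := by
          simp only [Overlap.quadForm_deflate_eq]; fun_prop
        exact le_of_tendsto (hcont.continuousWithinAt (s := Set.Ioi a)).tendsto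
          (Filter.eventually_of_mem (Ioo_mem_nhdsGT (hgt.trans hu₂b)) fun u hu => (hinside u hu).le)
    have hmonoI := monotoneOn_of_deflate_nonpos e Dp d J P v ha (u₂ := u₂) hnp
    have h1 : φ a ≤ φ ((a + u₂) / 2) := hmonoI ⟨le_rfl, hgt.le⟩ ⟨by linarith, by linarith⟩ (by linarith)
    have h2 : φ ((a + u₂) / 2) < φ u₂ := hmono ⟨by linarith, by linarith [hu₂b]⟩ ⟨hgt, hu₂b⟩ (by linarith)
    linarith

/-- **STRADDLE (bottom).**  `P k ⪰ 0`, `Dm < e`, `0 < ã′ ≤ b̃′`.  Suppose that in the direction `v` the `Dm`-deflated form is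
`≤ 0` on `(0, ã′]`, `> 0` on `(ã′, b̃′)` and `< 0` after `b̃′` (the bottom-deflated pivot pencil `−F̃_{Dm}` has the
directional island `(ã′, b̃′)`).  If `vᵀF(u₂)v < 0` for some `u₂ > 0`, then `vᵀF(b̃′)v < 0`: the island of `F` in the
direction `v` contains the END of the bottom-deflated island. -/
theorem neg_at_end_of_deflateBot_island (e Dm : ℕ) (d : Fin K → ℕ) (J : Matrix (Fin 2) (Fin 2) ℝ)
    (P : Fin K → Matrix (Fin 2) (Fin 2) ℝ) (hP : ∀ k, (P k).PosSemidef) (hDm : Dm < e) (v : Fin 2 → ℝ)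
    {a b : ℝ} (ha : 0 < a) (hab : a ≤ b)
    (hbefore : ∀ u : ℝ, 0 < u → u ≤ a → dotProduct v (((((Dm : ℝ) - e) * u ^ e) • J
        + ∑ k, (((Dm : ℝ) - d k) * u ^ d k) • P k).mulVec v) ≤ 0)
    (hinside : ∀ u ∈ Set.Ioo a b, 0 < dotProduct v (((((Dm : ℝ) - e) * u ^ e) • J
        + ∑ k, (((Dm : ℝ) - d k) * u ^ d k) • P k).mulVec v))
    (hafter : ∀ u : ℝ, b < u → dotProduct v (((((Dm : ℝ) - e) * u ^ e) • J
        + ∑ k, (((Dm : ℝ) - d k) * u ^ d k) • P k).mulVec v) < 0)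
    {u₂ : ℝ} (hu₂ : 0 < u₂) (hneg : dotProduct v ((u₂ ^ e • J + ∑ k, u₂ ^ d k • P k).mulVec v) < 0) :
    dotProduct v ((b ^ e • J + ∑ k, b ^ d k • P k).mulVec v) < 0 := by
  set φ : ℝ → ℝ := fun u => dotProduct v ((u ^ e • J + ∑ k, u ^ d k • P k).mulVec v) / u ^ Dm with hφ
  have hb : 0 < b := ha.trans_le hab
  have hφu₂ : φ u₂ < 0 := div_neg_of_neg_of_pos hneg (pow_pos hu₂ _)
  -- `a < u₂` by containment
  have hau₂ : a < u₂ := by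
    by_contra h
    rw [not_lt] at h
    have := nonneg_until_of_deflateBot_nonpos_until e Dm d J P hP hDm v hbefore hu₂ h
    linarith
  suffices hφb : φ b < 0 by
    have : φ b * b ^ Dm = dotProduct v ((b ^ e • J + ∑ k, b ^ d k • P k).mulVec v) := by
      simp only [hφ]; rw [div_mul_cancel₀ _ (pow_ne_zero _ hb.ne')]
    rw [← this]; exact mul_neg_of_neg_of_pos hφb (pow_pos hb _)
  have hcont : ContinuousAt (fun u : ℝ => dotProduct v (((((Dm : ℝ) - e) * u ^ e) • J
      + ∑ k, (((Dm : ℝ) - d k) * u ^ d k) • P k).mulVec v)) b := by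
    simp only [Overlap.quadForm_deflate_eq]; fun_prop
  rcases lt_trichotomy u₂ b with hlt | heq | hgt
  · -- strictly decreasing on `(a, b)`: `φ b ≤ φ (mid) < φ u₂`
    have hanti := Passage.quadForm_div_pow_strictAntiOn e Dm d J P v ha.le hinside
    have hnn : ∀ u ∈ Set.Icc ((u₂ + b) / 2) b, 0 ≤ dotProduct v (((((Dm : ℝ) - e) * u ^ e) • J
        + ∑ k, (((Dm : ℝ) - d k) * u ^ d k) • P k).mulVec v) := by
      intro u hu
      rcases lt_or_eq_of_le hu.2 with h | h
      · exact (hinside u ⟨by linarith [hu.1], h⟩).le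
      · rw [h]
        exact ge_of_tendsto (hcont.continuousWithinAt (s := Set.Iio b)).tendsto
          (Filter.eventually_of_mem (Ioo_mem_nhdsLT (hau₂.trans hlt))
            fun u hu => (hinside u hu).le)
    have hmonoI := antitoneOn_of_deflate_nonneg e Dm d J P v (by linarith : (0:ℝ) < (u₂ + b) / 2) (u₂ := b) hnn
    have h1 : φ b ≤ φ ((u₂ + b) / 2) := hmonoI ⟨le_rfl, by linarith⟩ ⟨by linarith, le_rfl⟩ (by linarith)
    have h2 : φ ((u₂ + b) / 2) < φ u₂ := hanti ⟨hau₂, hlt⟩ ⟨by linarith, by linarith⟩ (by linarith)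
    linarith
  · rw [← heq]; exact hφu₂
  · -- strictly increasing after `b`: `φ b ≤ φ (mid) < φ u₂`
    have hmono := Passage.quadForm_div_pow_strictMonoOn e Dm d J P v hb.le (b := u₂ + 1)
      (fun u hu => hafter u hu.1)
    have hnp : ∀ u ∈ Set.Icc b ((b + u₂) / 2), dotProduct v (((((Dm : ℝ) - e) * u ^ e) • J
        + ∑ k, (((Dm : ℝ) - d k) * u ^ d k) • P k).mulVec v) ≤ 0 := by
      intro u hu
      rcases lt_or_eq_of_le hu.1 with h | h
      · exact (hafter u h).le
      · rw [← h]
        exact le_of_tendsto (hcont.continuousWithinAt (s := Set.Ioi b)).tendsto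
          (Filter.eventually_of_mem (Ioo_mem_nhdsGT hgt) fun u hu => (hafter u hu.1).le)
    have hmonoI := monotoneOn_of_deflate_nonpos e Dm d J P v hb (u₂ := (b + u₂) / 2) hnp
    have h1 : φ b ≤ φ ((b + u₂) / 2) := hmonoI ⟨le_rfl, by linarith⟩ ⟨by linarith, le_rfl⟩ (by linarith)
    have h2 : φ ((b + u₂) / 2) < φ u₂ := hmono ⟨by linarith, by linarith⟩ ⟨hgt, by linarith⟩ (by linarith)
    linarith

end Summit.ValiantsHypothesis.ValiantsHypothesis.Theorems.LacunarySymmetroidMatrixDescartes.Pivot.Fibres
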